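import Mathlib
import Summits.NavierStokesRegularity.NavierStokesRegularity.Theorems.EulerZoomLiouvillePowerGaugeEulerLiouvilleSelfSimilarPressureParkingAverage
import Summits.NavierStokesRegularity.NavierStokesRegularity.Theorems.EulerZoomLiouvillePowerGaugeEulerLiouvilleSelfSimilarBernoulliSqueezePressureThin
import Literature.Analysis.FluidPDE.SelfSimilarEulerPowerSpreadExclusion
import HarnessLib

/-!
# «FAR PRESSURISED POINTS SIT NEXT TO GRADIENT SPIKES» — MEMBER FORM (crux binders verbatim)
# (crux `EulerZoomLiouville.PowerGaugeEulerLiouville` = stmt-NavierStokesRegularity-19832, THE ONE STATEMENT; LEAD ns-typeII-p2 g12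
# RESIDUE-MEMO-19832-g12 §4 (A2) / §5, «ezl-w1 g4 parking member» of the v69 queue; width seat ns-ezl-w1 g4)

Route №10 `EulerZoomLiouville` (NavierStokesRegularity).  The profile-level portrait theorem
`PressureParking.exists_gradient_spike_near_pressurised_point` (`…SelfSimilarPressureParkingAverage`, this seat) at MEMBER level,
with the crux hypotheses verbatim (`0 < ρ < 1`; the class gauges at the origin; exactly self-similar velocity AND pressure with
profiles `V ∈ C²`, `P`): for EVERY classical pressure `P′` of `V` there is the bridge constant `c₀` with `P = P′ + c₀` a.e.
(`WeakToClassical.pressureProfile_ae_eq_add_const`), and for every `κ > 0` a radius `L₁` such that for all `L ≥ L₁` every point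
`x₀ ∈ B̄_L(0)` with `P′(x₀) + c₀ ≥ 3κL²` has a point `z` with `‖z − x₀‖ ≤ 2δ_L` and `‖DV(z)‖² ≥ m κ L²/(48 v₁ δ_L²)`, where
`δ_L = (12 c_E (3L)^{1−ρ} + 1)/(m κ L²)`, `c_E = (1−ρ)c/(2+ρ)` (the profile's `E`-growth constant, `NeedleThinCore.selfSimilar_shell_inputs`),
`m = baseBumpMass ℝ³`, `v₁ = vol B₁`: the inputs of the profile theorem are supplied by the class — `E`-growth
`∫_{B_L}‖DV‖² ≤ c_E L^{1−ρ}` and the weighted `D`-datum `∫|P|^{3/2}‖y‖^{2ρ−2} ≤ (2−2ρ)c/(2+ρ)` (`profile_pressure_weight_of_gaugeD`),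
transported to the normalised classical pressure `P′ + c₀` (`IsSelfSimilarEulerProfile.add_const`).

* **`exists_gradient_spike_near_pressurised_point_member`** — the statement above.

HONEST LABEL: portrait stratum (nothing here excludes a needle).  WHAT THIS IS NOT: not NS, not E — `--supports` stmt-19832 on the
MODEL lattice; 19832 OPEN; NS regularity NOT proved. [folklore; GilbargTrudinger2001 Thm 2.1; ConstantinIgnatovaVicol2026Putative
§3.1.1 (3.3)]
-/

noncomputable section

-- flat `Theorems/<Route><Decl>…` files of one crux share the namespace of the crux (tree convention)
set_option linter.dupNamespace false

open MeasureTheory Set Filter Topology Metric Function InnerProductSpace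
open scoped RealInnerProductSpace NNReal ENNReal

namespace Summit.NavierStokesRegularity.NavierStokesRegularity.Theorems.PowerGaugeEulerLiouville.PressureParking

open Literature.Analysis Literature.Analysis.FluidPDE

/-- **«FAR PRESSURISED POINTS SIT NEXT TO GRADIENT SPIKES», MEMBER FORM** (crux binders verbatim, `0 < ρ < 1`).  For an exactly
self-similar member of the class with `C²` velocity profile `V` and ANY classical pressure `P′` of `V`: with the bridge constant `c₀`
(`P = P′ + c₀` a.e.) and `c_E = (1−ρ)c/(2+ρ)`, for every `κ > 0` there is `L₁ ≥ 1` such that for all `L ≥ L₁` and all `x₀` with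
`‖x₀‖ ≤ L` and `3κL² ≤ P′(x₀) + c₀` some `z` with `‖z − x₀‖ ≤ 2δ_L`, `δ_L = (12 c_E (3L)^{1−ρ} + 1)/(m κ L²)`, has
`‖DV(z)‖² ≥ m κ L²/(48 v₁ δ_L²)` — the profile theorem `exists_gradient_spike_near_pressurised_point` fed by the class data
(`NeedleThinCore.selfSimilar_shell_inputs`, `profile_pressure_weight_of_gaugeD`, `WeakToClassical.pressureProfile_ae_eq_add_const`).
[folklore; GilbargTrudinger2001 Thm 2.1] -/
theorem exists_gradient_spike_near_pressurised_point_member {ρ : ℝ} (hρ : 0 < ρ) (hρ1 : ρ < 1)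
    {u : ℝ → EuclideanSpace ℝ (Fin 3) → EuclideanSpace ℝ (Fin 3)} {p : ℝ → EuclideanSpace ℝ (Fin 3) → ℝ}
    {H : ℝ → EuclideanSpace ℝ (Fin 3) → EuclideanSpace ℝ (Fin 3) →L[ℝ] EuclideanSpace ℝ (Fin 3)} {c : ℝ≥0}
    (hsw : IsSuitableWeakSolutionOn (slab (EuclideanSpace ℝ (Fin 3)) (Iio 0) isOpen_Iio) 0 0 u p)
    (hH : HasWeakSpatialGradientOn (slab (EuclideanSpace ℝ (Fin 3)) (Iio 0) isOpen_Iio) u H)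
    (hgauge : ∀ a : ℝ, 0 < a →
      ENNReal.ofReal (a ^ (2 * ρ)) * cknA a (0 : ℝ × EuclideanSpace ℝ (Fin 3)) u +
          ENNReal.ofReal (a ^ ρ) * cknE a (0 : ℝ × EuclideanSpace ℝ (Fin 3)) H +
        ENNReal.ofReal (a ^ (2 * ρ)) * cknD a (0 : ℝ × EuclideanSpace ℝ (Fin 3)) p ≤ (c : ℝ≥0∞))
    {V : EuclideanSpace ℝ (Fin 3) → EuclideanSpace ℝ (Fin 3)} {P : EuclideanSpace ℝ (Fin 3) → ℝ}
    (hu : ∀ τ : ℝ, τ < 0 → u τ = selfSimilarCollapse (1 / (2 + ρ)) 0 V τ)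
    (hp : ∀ τ : ℝ, τ < 0 → p τ = selfSimilarCollapsePressure (1 / (2 + ρ)) 0 P τ)
    (hV : ContDiff ℝ 2 V) {P' : EuclideanSpace ℝ (Fin 3) → ℝ}
    (hprof : IsSelfSimilarEulerProfile (1 / (2 + ρ)) 0 V P') {κ : ℝ} (hκ : 0 < κ) :
    ∃ c₀ L₁ : ℝ, 1 ≤ L₁ ∧ (P =ᵐ[volume] fun y => P' y + c₀) ∧
      ∀ L : ℝ, L₁ ≤ L → ∀ x₀ : EuclideanSpace ℝ (Fin 3), ‖x₀‖ ≤ L → 3 * κ * L ^ 2 ≤ P' x₀ + c₀ →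
        ∃ z : EuclideanSpace ℝ (Fin 3),
          ‖z - x₀‖ ≤ 2 * ((12 * ((1 - ρ) / (2 + ρ) * c) * (3 * L) ^ (1 - ρ) + 1) /
              (baseBumpMass (EuclideanSpace ℝ (Fin 3)) * κ * L ^ 2)) ∧
          baseBumpMass (EuclideanSpace ℝ (Fin 3)) * κ * L ^ 2 /
              (48 * (volume (ball (0 : EuclideanSpace ℝ (Fin 3)) 1)).toReal *
                ((12 * ((1 - ρ) / (2 + ρ) * c) * (3 * L) ^ (1 - ρ) + 1) /
                  (baseBumpMass (EuclideanSpace ℝ (Fin 3)) * κ * L ^ 2)) ^ 2) ≤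
            ‖fderiv ℝ V z‖ ^ 2 := by
  have h2ρ : (0 : ℝ) < 2 + ρ := by linarith
  -- the class pressure profile and its weighted `D`-datum
  have hD : ∀ a : ℝ, 0 < a → ENNReal.ofReal (a ^ (2 * ρ)) *
      cknD a (0 : ℝ × EuclideanSpace ℝ (Fin 3)) p ≤ (c : ℝ≥0∞) :=
    fun a ha => le_trans le_add_self (hgauge a ha)
  have hpm : AEStronglyMeasurable (uncurry p)
      (volume.restrict (Iio (0 : ℝ) ×ˢ (univ : Set (EuclideanSpace ℝ (Fin 3))))) := by
    have := hsw.distributional.2.2.1.aestronglyMeasurable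
    simpa [slab] using this
  have hPm := aestronglyMeasurable_pressureProfile hpm hp
  have hDprof := profile_pressure_weight_of_gaugeD hρ hρ1 hpm hp hD
  have hP1 : LocallyIntegrable P volume :=
    EnergySaturation.locallyIntegrable_pressure_of_weight hρ1 hPm
      (ENNReal.mul_ne_top ENNReal.ofReal_ne_top ENNReal.coe_ne_top) hDprof
  -- the bridge `P = P' + c₀` a.e.
  obtain ⟨c₀, hc₀⟩ := WeakToClassical.pressureProfile_ae_eq_add_const hsw.distributional hu hp hV hP1 hprof
  -- the normalised classical pressure `P' + c₀` carries the weighted `D`-datum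
  have hprof'' : IsSelfSimilarEulerProfile (1 / (2 + ρ)) 0 V (fun y => P' y + c₀) := hprof.add_const
  have hCD : (0 : ℝ) ≤ (2 - 2 * ρ) / (2 + ρ) * c := by
    have : (0 : ℝ) ≤ (2 - 2 * ρ) / (2 + ρ) := div_nonneg (by linarith) h2ρ.le
    exact mul_nonneg this (NNReal.coe_nonneg c)
  have hD'' : ∫⁻ y, ‖P' y + c₀‖ₑ ^ (3 / 2 : ℝ) * ENNReal.ofReal (‖y‖ ^ (2 * ρ - 2)) ≤
      ENNReal.ofReal ((2 - 2 * ρ) / (2 + ρ) * c) := by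
    have e : (fun y : EuclideanSpace ℝ (Fin 3) => ‖P' y + c₀‖ₑ ^ (3 / 2 : ℝ) * ENNReal.ofReal (‖y‖ ^ (2 * ρ - 2))) =ᵐ[volume]
        fun y => ‖P y‖ₑ ^ (3 / 2 : ℝ) * ENNReal.ofReal (‖y‖ ^ (2 * ρ - 2)) := by
      filter_upwards [hc₀] with y hy
      rw [hy]
    rw [lintegral_congr_ae e]
    refine hDprof.trans (le_of_eq ?_)
    rw [ENNReal.ofReal_mul (by apply div_nonneg <;> linarith), ENNReal.ofReal_coe_nnreal]
  -- the `E`-growth of the profile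
  have hV1 : ContDiff ℝ 1 V := hV.of_le (by norm_num)
  have hE : ∀ L : ℝ, 0 < L → ∫⁻ y in ball (0 : EuclideanSpace ℝ (Fin 3)) L, ‖fderiv ℝ V y‖ₑ ^ 2 ≤
      ENNReal.ofReal ((1 - ρ) / (2 + ρ) * c * L ^ (1 - ρ)) := fun L hL =>
    (NeedleThinCore.selfSimilar_shell_inputs hρ hρ1 hsw hH hgauge hu hp hV1 hL).1
  have hcE : (0 : ℝ) ≤ (1 - ρ) / (2 + ρ) * c := by
    have : (0 : ℝ) ≤ (1 - ρ) / (2 + ρ) := div_nonneg (by linarith) h2ρ.le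
    exact mul_nonneg this (NNReal.coe_nonneg c)
  obtain ⟨L₁, hL₁, hmain⟩ :=
    exists_gradient_spike_near_pressurised_point hprof'' hρ.le hρ1 hcE hCD hE hD'' hκ
  exact ⟨c₀, L₁, hL₁, hc₀, fun L hL x₀ hx₀ hPx => hmain L hL x₀ hx₀ hPx⟩

end Summit.NavierStokesRegularity.NavierStokesRegularity.Theorems.PowerGaugeEulerLiouville.PressureParking

end
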